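import Literature.Computability.Cryptography.LWEPrimePowerDigitTest
import Literature.Computability.Cryptography.LWEPrimePowerLevelSelect
import Literature.Computability.Cryptography.LWEPrimePowerAggregate
import Literature.Computability.Cryptography.LWEPrimePowerDriven
import Literature.Computability.Cryptography.LWEPiLawMaps
import HarnessLib

/-!
# The per-input solver of the Micciancio–Peikert reduction, I: items, estimation units and digit trials computed from raw data have the analysis' laws (MP12, Thm. 3.1, machine bridge)

Topic `Computability/Cryptography` (LWE), grouping namespace `LWE.MP12`, sequel of
`LWEPrimePowerDriven.lean` (laws of data/coin-driven computations) joining the phase definitions of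
`LWEPrimePowerLevelSelect.lean` (`mixLaw`, `ansLaw`, `estLaw`) and `LWEPrimePowerDigitTest.lean`
(`rawX`, `rawY`, `digitTrialAns`, `testOut`). Proved material (no named fact) towards
`Literature.Computability.Cryptography.blprs_gapSVP_sqrt_dim_to_lwe_classical` (**pqc.S21**),
component Thm. 2.17 = Micciancio–Peikert 2012, Thm. 3.1 (hypothesis `h₂` of
`BLPRSReduction.…_of_components`).

The machine computes every oracle query from RAW material: `K'+1` raw input samples summed into one
sample of the aggregated noise (`sumSamples`), a fresh uniform level scalar `r` (the sample becomes
`(a, b + r·g)`, `hybridize`), the transform and re-spread scalars, the shifts, and — for each call of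
the randomised distinguisher — a fresh coin slice `c : C`, the call returning `f u c` for a fixed
deterministic `f` (so the kernel of the analysis is `K u = U_C.map (f u)`). This file proves that the
so computed

* item `(a, b + r·g)` has the law `hybridSample χK s g` (`law_item`), `χK = sumNoise χ₁ (K'+1)`;
* estimation unit of level `j` (a shifted block) has the law `mixLaw χK gen j`, and the `N'` answers
  of level `j` the law `ansLaw K (mixLaw χK gen j) N'` (`law_estUnit`, **`law_estAnswers`**);
* digit trial (the `x`- and `y`-verdict tuples) has the law `digitTrialAns K χK N i⋆ c cm t s`
  (**`law_trialVerdicts`**), hence the `T`-trial test the law `testOut …` (**`law_testDet`**).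

## References

* D. Micciancio, C. Peikert, *Trapdoors for lattices: simpler, tighter, faster, smaller*, EUROCRYPT 2012,
  LNCS 7237; full version IACR ePrint 2011/501, §3, proof of Thm. 3.1, pp. 15–16. [MicciancioPeikert2012]
* S. Arora, B. Barak, *Computational Complexity: A Modern Approach*, CUP 2009, Def. 7.1.
  [AroraBarak2009]
-/

noncomputable section

open scoped ENNReal

namespace Literature.Computability.Cryptography

namespace LWE

namespace MP12

open Literature.Probability.Distributions

/-! ### Generic reshuffles -/

section Reshuffle

variable {α β γ δ : Type}

/-- `(P ⊗ Q).map F` as "bind over the SECOND factor outside". [folklore] -/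
theorem prodLaw_map_eq_bind_snd (P : PMF α) (Q : PMF β) (F : α × β → γ) :
    (prodLaw P Q).map F = Q.bind fun b => P.map fun a => F (a, b) := by
  rw [← prodLaw_map_swap Q P, PMF.map_comp, prodLaw, PMF.map_bind]
  refine congrArg _ (funext fun b => ?_)
  rw [PMF.map_comp]
  rfl

/-- `(P ⊗ Q).map F` as "bind over the first factor outside". [folklore] -/
theorem prodLaw_map_eq_bind_fst (P : PMF α) (Q : PMF β) (F : α × β → γ) :
    (prodLaw P Q).map F = P.bind fun a => Q.map fun b => F (a, b) := by
  rw [prodLaw, PMF.map_bind]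
  refine congrArg _ (funext fun a => ?_)
  rw [PMF.map_comp]
  rfl

/-- Regrouping two independent pairs. [folklore] -/
theorem prodLaw_prodLaw_map_prodProdProdComm (P : PMF α) (Q : PMF β) (P' : PMF γ) (Q' : PMF δ) :
    (prodLaw (prodLaw P Q) (prodLaw P' Q')).map (Equiv.prodProdProdComm α β γ δ) =
      prodLaw (prodLaw P P') (prodLaw Q Q') := by
  ext ⟨⟨a, c⟩, ⟨b, d⟩⟩
  rw [pmf_map_equiv_apply]
  simp only [Equiv.prodProdProdComm_symm, Equiv.prodProdProdComm_apply, prodLaw_apply]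
  ring

/-- **One batch of calls, answers only** (`LWEPrimePowerDriven.prodLaw_iidPMF_map_driven` with the
identity post-processing). [cite: AroraBarak2009, Def. 7.1] -/
theorem prodLaw_iidPMF_map_answers {D C Qu : Type} (P : PMF D) (μ : PMF C) (n : ℕ) (qry : D → Fin n → Qu)
    (f : Qu → C → Bool) :
    (prodLaw P (iidPMF μ n)).map (fun x i => f (qry x.1 i) (x.2 i)) =
      P.bind fun dat => indepLaw n fun i => μ.map (f (qry dat i)) := by
  rw [prodLaw_iidPMF_map_driven P μ n qry f (fun _ a => a)]
  exact congrArg _ (funext fun dat => PMF.map_id _)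

/-- `indepLaw` over `Fin K` is `piLaw`. [folklore] -/
theorem indepLaw_eq_piLaw {κ : Type} [Fintype κ] (K : ℕ) (P : Fin K → PMF κ) : indepLaw K P = piLaw P := by
  ext v
  rw [indepLaw_apply, piLaw_apply]

end Reshuffle

/-! ### Items: aggregated, hybridised samples -/

section Items

variable {ι : Type} [Fintype ι] [DecidableEq ι] {p : ℕ} [hp : Fact p.Prime] {e : ℕ}

/-- Hybridising a sample with a level scalar: `(a, b) ↦ (a, b + r·g)`. [cite: MicciancioPeikert2012, Thm. 3.1 proof (p. 15, definition of `Aʲ`)] -/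
def hybridize (g : ZMod (p ^ e)) (z : ((ι → ZMod (p ^ e)) × ZMod (p ^ e)) × ZMod (p ^ e)) :
    (ι → ZMod (p ^ e)) × ZMod (p ^ e) :=
  (z.1.1, z.1.2 + z.2 * g)

/-- **A sample with a fresh uniform level scalar is a hybrid sample.** [cite: MicciancioPeikert2012, Thm. 3.1 proof (p. 15)] -/
theorem prodLaw_map_hybridize (P : PMF ((ι → ZMod (p ^ e)) × ZMod (p ^ e))) (χ : PMF (ZMod (p ^ e)))
    (s : ι → ZMod (p ^ e)) (hP : P = lweSample χ s) (g : ZMod (p ^ e)) :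
    (prodLaw P (PMF.uniformOfFintype (ZMod (p ^ e)))).map (hybridize g) = hybridSample χ s g := by
  subst hP
  rw [prodLaw_map_eq_bind_snd]
  rfl

variable (K' : ℕ)

/-- **A raw item**: `K'+1` raw samples and a level scalar. [folklore] -/
abbrev RawItem (ι : Type) (p e K' : ℕ) := (Fin (K' + 1) → (ι → ZMod (p ^ e)) × ZMod (p ^ e)) × ZMod (p ^ e)

/-- The item of level `g`: sum the raw samples, hybridise. [cite: MicciancioPeikert2012, Thm. 3.1 proof (p. 15)] -/
def item (g : ZMod (p ^ e)) (z : RawItem ι p e K') : (ι → ZMod (p ^ e)) × ZMod (p ^ e) :=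
  hybridize g (sumSamples z.1, z.2)

/-- The law of a raw item for the secret `s` and raw noise `χ₁`. [folklore] -/
def rawItemLaw (χ₁ : PMF (ZMod (p ^ e))) (s : ι → ZMod (p ^ e)) : PMF (RawItem ι p e K') :=
  prodLaw (iidPMF (lweSample χ₁ s) (K' + 1)) (PMF.uniformOfFintype (ZMod (p ^ e)))

/-- **The item has the law `hybridSample χK s g`**, `χK = sumNoise χ₁ (K'+1)`. [cite: MicciancioPeikert2012, Thm. 3.1 proof (p. 15, first step and definition of `Aʲ`)] -/
theorem law_item (χ₁ : PMF (ZMod (p ^ e))) (s : ι → ZMod (p ^ e)) (g : ZMod (p ^ e)) :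
    (rawItemLaw K' χ₁ s).map (item K' g) = hybridSample (sumNoise (p ^ e) χ₁ (K' + 1)) s g := by
  rw [rawItemLaw, show item (ι := ι) K' g = hybridize g ∘ Prod.map sumSamples id from rfl, ← PMF.map_comp,
    prodLaw_map_prodMap, PMF.map_id, iidPMF_lweSample_map_sumSamples]
  exact prodLaw_map_hybridize _ _ s rfl g

end Items

/-! ### Phase 1: estimation units and their answers -/

section Est

variable {ι : Type} [Fintype ι] [DecidableEq ι] {p : ℕ} [hp : Fact p.Prime] {e : ℕ} (K' m N' : ℕ) {C : Type}
  [Fintype C] [Nonempty C]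

/-- **An estimation unit**: `m` raw items and a secret shift `τ`. [folklore] -/
abbrev EstUnit (ι : Type) (p e K' m : ℕ) := (Fin m → RawItem ι p e K') × (ι → ZMod (p ^ e))

/-- The estimation query of level `j`: the shifted block of level-`j` items. [cite: MicciancioPeikert2012, Thm. 3.1 proof (p. 15)] -/
def estBlock (j : ℕ) (u : EstUnit ι p e K' m) : Fin m → (ι → ZMod (p ^ e)) × ZMod (p ^ e) :=
  shiftSample u.2 ∘ fun i => item K' (gen p e j) (u.1 i)

/-- The law of an estimation unit. [folklore] -/
def estUnitLaw (χ₁ : PMF (ZMod (p ^ e))) (s : ι → ZMod (p ^ e)) : PMF (EstUnit ι p e K' m) :=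
  prodLaw (iidPMF (rawItemLaw K' χ₁ s) m) (PMF.uniformOfFintype (ι → ZMod (p ^ e)))

/-- **The estimation query has the law `mixLaw χK gen j`** (a level-`j` block for a uniform secret).
[cite: MicciancioPeikert2012, Thm. 3.1 proof (p. 15)] -/
theorem law_estBlock (χ₁ : PMF (ZMod (p ^ e))) (s : ι → ZMod (p ^ e)) (j : ℕ) :
    (estUnitLaw K' m χ₁ s).map (estBlock K' m j) = mixLaw (sumNoise (p ^ e) χ₁ (K' + 1)) (gen p e) j := by
  rw [estUnitLaw, prodLaw_map_eq_bind_snd, ← law_estQuery (χ := sumNoise (p ^ e) χ₁ (K' + 1)) (g := gen p e) s j]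
  refine congrArg _ (funext fun τ => ?_)
  rw [hybridSamples, lweSamples, ← hybridSample_eq, ← law_item K' χ₁ s, ← iidPMF_map, PMF.map_comp]
  rfl

variable (f : (Fin m → (ι → ZMod (p ^ e)) × ZMod (p ^ e)) → C → Bool)

/-- The `N'` answers of level `j`: the kernel sample `f` on each unit's query with the unit's coins.
[cite: AroraBarak2009, Def. 7.1] -/
def estAnswers (j : ℕ) (us : Fin N' → EstUnit ι p e K' m × C) : Fin N' → Bool :=
  fun k => f (estBlock K' m j (us k).1) (us k).2

/-- **The answers of level `j` have the law `ansLaw K (mixLaw χK gen j) N'`** with the kernel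
`K u = U_C.map (f u)`. [cite: MicciancioPeikert2012, Thm. 3.1 proof (p. 15)] -/
theorem law_estAnswers (χ₁ : PMF (ZMod (p ^ e))) (s : ι → ZMod (p ^ e)) (j : ℕ) :
    (iidPMF (prodLaw (estUnitLaw K' m χ₁ s) (PMF.uniformOfFintype C)) N').map (estAnswers K' m N' f j) =
      ansLaw (fun u => (PMF.uniformOfFintype C).map (f u)) (mixLaw (sumNoise (p ^ e) χ₁ (K' + 1)) (gen p e) j) N' := by
  have h := prodLaw_iidPMF_map_answers (iidPMF (estUnitLaw K' m χ₁ s) N') (PMF.uniformOfFintype C) N'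
    (fun us k => estBlock K' m j (us k)) f
  rw [← prodLaw_iidPMF_map_zip, PMF.map_comp]
  refine h.trans ?_
  rw [ansLaw, ← law_estBlock K' m χ₁ s j, ← iidPMF_map, PMF.bind_map]
  rfl

end Est

/-! ### Phase 2: the digit trial computed from raw data -/

section Trial

variable {ι : Type} [Fintype ι] [DecidableEq ι] {p : ℕ} [hp : Fact p.Prime] {e : ℕ} (K' m N : ℕ) {C : Type}
  [Fintype C] [Nonempty C]

/-- An `x`-item: transform scalar `l` and a raw item. [folklore] -/
abbrev XItem (ι : Type) (p e K' : ℕ) := ZMod (p ^ e) × RawItem ι p e K'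

/-- A `y`-item: re-spread scalar `ρ` and an `x`-item. [folklore] -/
abbrev YItem (ι : Type) (p e K' : ℕ) := ZMod (p ^ e) × XItem ι p e K'

/-- **The data of one digit trial**: the worst-case shift `τ`, `N` `x`-blocks and `N` `y`-units of `m`
items, and the coins of the `2N` calls. [folklore] -/
abbrev TrialData (ι : Type) (p e K' m N : ℕ) (C : Type) :=
  (ι → ZMod (p ^ e)) × (((Fin N → Fin m → XItem ι p e K') × (Fin N → Fin m → YItem ι p e K')) ×
    ((Fin N → C) × (Fin N → C)))

variable (i₀ : ℕ)

/-- The scalar-carrying level-`i⋆` pair of an `x`-item. [folklore] -/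
def xpair (z : XItem ι p e K') : ZMod (p ^ e) × ((ι → ZMod (p ^ e)) × ZMod (p ^ e)) := (z.1, item K' (gen p e i₀) z.2)

/-- The same for a `y`-item. [folklore] -/
def ypair (z : YItem ι p e K') : ZMod (p ^ e) × (ZMod (p ^ e) × ((ι → ZMod (p ^ e)) × ZMod (p ^ e))) :=
  (z.1, xpair K' i₀ z.2)

variable (f : (Fin m → (ι → ZMod (p ^ e)) × ZMod (p ^ e)) → C → Bool)

/-- **The verdicts of one digit trial** for coordinate `c`, multiplier `cm`, candidate shift `t`: the
`x`-answers `f (shift_τ (xmap …)) cx` and the `y`-answers `f (respread ∘ shift_τ (ymap …)) cy`.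
[cite: MicciancioPeikert2012, Thm. 3.1 proof (pp. 15–16)] -/
def trialVerdicts (c : ι) (cm : ZMod (p ^ e)) (t : ι → ZMod (p ^ e)) (td : TrialData ι p e K' m N C) :
    (Fin N → Bool) × (Fin N → Bool) :=
  (fun k => f (qx td.1 fun q => xmap c cm t (xpair K' i₀ (td.2.1.1 k q))) (td.2.2.1 k),
    fun k => f (qy (gen p e (i₀ + 1)) td.1 fun q => ymap c cm t (ypair K' i₀ (td.2.1.2 k q))) (td.2.2.2 k))

/-- The law of the data of one trial. [folklore] -/
def trialDataLaw (χ₁ : PMF (ZMod (p ^ e))) (s : ι → ZMod (p ^ e)) : PMF (TrialData ι p e K' m N C) :=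
  prodLaw (PMF.uniformOfFintype (ι → ZMod (p ^ e)))
    (prodLaw
      (prodLaw (iidPMF (iidPMF (prodLaw (PMF.uniformOfFintype (ZMod (p ^ e))) (rawItemLaw K' χ₁ s)) m) N)
        (iidPMF (iidPMF (prodLaw (PMF.uniformOfFintype (ZMod (p ^ e)))
          (prodLaw (PMF.uniformOfFintype (ZMod (p ^ e))) (rawItemLaw K' χ₁ s))) m) N))
      (prodLaw (iidPMF (PMF.uniformOfFintype C) N) (iidPMF (PMF.uniformOfFintype C) N)))

/-- One scalar-carrying pair from an `x`-item has the law `pairLaw (hybridSample χK s (gen i⋆))`. [folklore] -/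
theorem law_xpair (χ₁ : PMF (ZMod (p ^ e))) (s : ι → ZMod (p ^ e)) :
    (prodLaw (PMF.uniformOfFintype (ZMod (p ^ e))) (rawItemLaw K' χ₁ s)).map (xpair K' i₀) =
      pairLaw (hybridSample (sumNoise (p ^ e) χ₁ (K' + 1)) s (gen p e i₀)) := by
  rw [show xpair (ι := ι) K' i₀ = Prod.map id (item K' (gen p e i₀)) from rfl, prodLaw_map_prodMap, PMF.map_id,
    law_item, pairLaw_eq_prodLaw]

/-- The same for a `y`-item. [folklore] -/
theorem law_ypair (χ₁ : PMF (ZMod (p ^ e))) (s : ι → ZMod (p ^ e)) :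
    (prodLaw (PMF.uniformOfFintype (ZMod (p ^ e))) (prodLaw (PMF.uniformOfFintype (ZMod (p ^ e))) (rawItemLaw K' χ₁ s))).map
        (ypair K' i₀) =
      prodLaw (PMF.uniformOfFintype (ZMod (p ^ e))) (pairLaw (hybridSample (sumNoise (p ^ e) χ₁ (K' + 1)) s (gen p e i₀))) := by
  rw [show ypair (ι := ι) K' i₀ = Prod.map id (xpair K' i₀) from rfl, prodLaw_map_prodMap, PMF.map_id, law_xpair]

/-- The `x`-pairs have the law `rawX`. [folklore] -/
theorem law_xpairs (χ₁ : PMF (ZMod (p ^ e))) (s : ι → ZMod (p ^ e)) :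
    (iidPMF (iidPMF (prodLaw (PMF.uniformOfFintype (ZMod (p ^ e))) (rawItemLaw K' χ₁ s)) m) N).map
        (fun xr k q => xpair K' i₀ (xr k q)) = rawX (sumNoise (p ^ e) χ₁ (K' + 1)) N i₀ s := by
  rw [rawX, ← law_xpair K' i₀ χ₁ s, ← iidPMF_map, ← iidPMF_map]
  rfl

/-- The `y`-pairs have the law `rawY`. [folklore] -/
theorem law_ypairs (χ₁ : PMF (ZMod (p ^ e))) (s : ι → ZMod (p ^ e)) :
    (iidPMF (iidPMF (prodLaw (PMF.uniformOfFintype (ZMod (p ^ e)))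
        (prodLaw (PMF.uniformOfFintype (ZMod (p ^ e))) (rawItemLaw K' χ₁ s))) m) N).map
        (fun yr k q => ypair K' i₀ (yr k q)) = rawY (sumNoise (p ^ e) χ₁ (K' + 1)) N i₀ s := by
  rw [rawY, ← law_ypair K' i₀ χ₁ s, ← iidPMF_map, ← iidPMF_map]
  rfl

/-- **The verdicts of the trial computed from raw data have the law `digitTrialAns`** with the kernel
`K u = U_C.map (f u)`. [cite: MicciancioPeikert2012, Thm. 3.1 proof (pp. 15–16)] -/
theorem law_trialVerdicts (χ₁ : PMF (ZMod (p ^ e))) (s : ι → ZMod (p ^ e)) (c : ι) (cm : ZMod (p ^ e))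
    (t : ι → ZMod (p ^ e)) :
    (trialDataLaw K' m N χ₁ s (C := C)).map (trialVerdicts K' m N i₀ f c cm t) =
      digitTrialAns (fun u => (PMF.uniformOfFintype C).map (f u)) (sumNoise (p ^ e) χ₁ (K' + 1)) N i₀ c cm t s := by
  rw [trialDataLaw, prodLaw_map_eq_bind_fst, digitTrialAns]
  refine congrArg _ (funext fun τ => ?_)
  have hx := prodLaw_iidPMF_map_answers
    (iidPMF (iidPMF (prodLaw (PMF.uniformOfFintype (ZMod (p ^ e))) (rawItemLaw K' χ₁ s)) m) N)
    (PMF.uniformOfFintype C) N (fun xr k => qx τ fun q => xmap c cm t (xpair K' i₀ (xr k q))) f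
  have hy := prodLaw_iidPMF_map_answers
    (iidPMF (iidPMF (prodLaw (PMF.uniformOfFintype (ZMod (p ^ e)))
      (prodLaw (PMF.uniformOfFintype (ZMod (p ^ e))) (rawItemLaw K' χ₁ s))) m) N)
    (PMF.uniformOfFintype C) N (fun yr k => qy (gen p e (i₀ + 1)) τ fun q => ymap c cm t (ypair K' i₀ (yr k q))) f
  -- regroup `((xr, yr), (cx, cy)) ↦ ((xr, cx), (yr, cy))`: the two halves are driven batches
  have hre := prodLaw_prodLaw_map_prodProdProdComm
    (iidPMF (iidPMF (prodLaw (PMF.uniformOfFintype (ZMod (p ^ e))) (rawItemLaw K' χ₁ s)) m) N)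
    (iidPMF (iidPMF (prodLaw (PMF.uniformOfFintype (ZMod (p ^ e)))
      (prodLaw (PMF.uniformOfFintype (ZMod (p ^ e))) (rawItemLaw K' χ₁ s))) m) N)
    (iidPMF (PMF.uniformOfFintype C) N) (iidPMF (PMF.uniformOfFintype C) N)
  calc _ = ((prodLaw (prodLaw
            (iidPMF (iidPMF (prodLaw (PMF.uniformOfFintype (ZMod (p ^ e))) (rawItemLaw K' χ₁ s)) m) N)
            (iidPMF (iidPMF (prodLaw (PMF.uniformOfFintype (ZMod (p ^ e)))
              (prodLaw (PMF.uniformOfFintype (ZMod (p ^ e))) (rawItemLaw K' χ₁ s))) m) N))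
          (prodLaw (iidPMF (PMF.uniformOfFintype C) N) (iidPMF (PMF.uniformOfFintype C) N))).map
            (Equiv.prodProdProdComm _ _ _ _)).map
          (Prod.map (fun x i => f (qx τ fun q => xmap c cm t (xpair K' i₀ (x.1 i q))) (x.2 i))
            (fun y i => f (qy (gen p e (i₀ + 1)) τ fun q => ymap c cm t (ypair K' i₀ (y.1 i q))) (y.2 i))) := by
        rw [PMF.map_comp]
        rfl
    _ = _ := by
        rw [hre, prodLaw_map_prodMap, hx, hy, ← law_xpairs K' m N i₀ χ₁ s, ← law_ypairs K' m N i₀ χ₁ s,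
          PMF.map_comp, PMF.map_comp, PMF.bind_map, PMF.bind_map]
        rfl

end Trial

end MP12

end LWE

end Literature.Computability.Cryptography

end
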